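import Mathlib
import Summits.Ventures.PercRepro2.OneTypedEdge
import Summits.Ventures.PercRepro2.TypedSplit
import Summits.Ventures.PercRepro2.TypedUntouched
import Summits.Ventures.PercRepro2.TypedSwapRoots
import Summits.Ventures.PercRepro2.TypedCoincRootEdge

/-!
# The type-2 triangles `{a₁, b, a₃}` and `{a₁, o, a₃}` kill every typed base (blind cell PercRepro2,
night-3 g14, 2026-08-27; `proofs/NIGHT3-CERT.md` §23)

**State level** (two more «symmetrised-pointwise» identities, `decide`): the `S₃`-symmetrised
kernel vanishes on every state triple in which two states carry `o ∈ C(a₁)` and `a₃ ∈ C(a₁)`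
(`KBsym_eq_zero_of_two_Lo3`, 8,192 cases), and on every triple in which two states carry
`b ∈ C(a₁)` and `a₃ ∈ U` (`KBsym_eq_zero_of_two_Lb_U3`, 32,768 cases — the general form of
`KBsym_eq_zero_of_two_Lb3`).  These are two of the 28 minimal monotone vanishing conditions of the
symmetrised kernel on state triples (`mining/night-3/g14/symclass.py`).

**Graph level**: three typed edges of type `2` forming a triangle on `a₁`, `a₃` and a third vertex
`v`: each edge is closed in exactly one copy, so two copies carry at least two of the three edges and
in those copies `v` and `a₃` lie in `C(a₁)` (`two_copies_two_open`, a 512-case Bool check).  For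
`v = b` the typed base vanishes by `KBsym_eq_zero_of_two_Lb3`, for `v = o` by
`KBsym_eq_zero_of_two_Lo3` (`typedCount_eq_zero_of_triangle_b`, `typedCount_eq_zero_of_triangle_o`;
mirrors at `a₂`).  On the ∣F∣ = 9 domain of record the `o`-triangle is the zero set of 112 positive
instances read off by night-3 g13 («not pointwise») and the `b`-triangle of 175 + 111 more; random
census `census_tri.py`: 0 / 4,108 and 0 / 4,128 nonzero (the control triangle `{a₁, o, b}`: 1,124 /
3,920).  Nothing here asserts anything about the original lane.
-/

namespace Summit.Ventures.PercRepro2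

open UnionCluster

namespace CovForm

namespace Triangle

open OneTyped Untouched CoincRoot

/-! ## The state-level identities -/

section States

/-- **Two states carrying `o` and `a₃` in `C(a₁)`** kill the symmetrised kernel (8,192 cases). -/
theorem KBsym_eq_zero_of_two_Lo3 (x : St) (q Lb Hb q' Lb' Hb' : Bool) :
    KBsym x (mkSt q true Lb true false Hb false) (mkSt q' true Lb' true false Hb' false) = 0 := by
  revert x q Lb Hb q' Lb' Hb'
  decide +kernel

/-- **Two states carrying `b ∈ C(a₁)` and `a₃ ∈ U`** kill the symmetrised kernel (32,768 cases). -/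
theorem KBsym_eq_zero_of_two_Lb_U3 (x : St) (q Lo Ho L3 q' Lo' Ho' L3' : Bool) :
    KBsym x (mkSt q Lo true L3 Ho false (!L3)) (mkSt q' Lo' true L3' Ho' false (!L3')) = 0 := by
  revert x q Lo Ho L3 q' Lo' Ho' L3'
  decide +kernel

end States

/-! ## The triangle colourings -/

section Graph

open Classical

variable {V : Type*} {E : Type*} [Fintype E] [DecidableEq E]
variable (ends : E → Sym2 V) (o a₁ a₂ a₃ b : V)

omit [Fintype E] [DecidableEq E] in
/-- Three edges each open in exactly two copies: two copies carry at least two of them. -/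
lemma two_copies_two_open {x y w : Config E} {e f g : E}
    (he : (x e).toNat + (y e).toNat + (w e).toNat = 2)
    (hf : (x f).toNat + (y f).toNat + (w f).toNat = 2)
    (hg : (x g).toNat + (y g).toNat + (w g).toNat = 2) :
    let two : Config E → Prop := fun u =>
      (u e = true ∧ u f = true) ∨ (u e = true ∧ u g = true) ∨ (u f = true ∧ u g = true)
    (two x ∧ two y) ∨ (two x ∧ two w) ∨ (two y ∧ two w) := by
  intro two
  cases hxe : x e <;> cases hye : y e <;> cases hwe : w e <;> cases hxf : x f <;> cases hyf : y f <;>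
    cases hwf : w f <;> cases hxg : x g <;> cases hyg : y g <;> cases hwg : w g <;> simp_all [two]

omit [Fintype E] [DecidableEq E] in
/-- A copy carrying two edges of the triangle `{a₁, v, a₃}` (edges `e = {a₁, v}`, `f = {a₁, a₃}`,
`g = {v, a₃}`) joins `a₁` to `v` and to `a₃`. -/
lemma conn_of_two_open {v : V} {e f g : E} (he : ends e = s(a₁, v)) (hf : ends f = s(a₁, a₃))
    (hg : ends g = s(v, a₃)) (u : Config E)
    (h : (u e = true ∧ u f = true) ∨ (u e = true ∧ u g = true) ∨ (u f = true ∧ u g = true)) :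
    Conn ends u a₁ v ∧ Conn ends u a₁ a₃ := by
  have ce : u e = true → Conn ends u a₁ v := fun hu => conn_of_openAdj ⟨e, hu, he⟩
  have cf : u f = true → Conn ends u a₁ a₃ := fun hu => conn_of_openAdj ⟨f, hu, hf⟩
  have cg : u g = true → Conn ends u v a₃ := fun hu => conn_of_openAdj ⟨g, hu, hg⟩
  rcases h with ⟨h1, h2⟩ | ⟨h1, h2⟩ | ⟨h1, h2⟩
  · exact ⟨ce h1, cf h2⟩
  · exact ⟨ce h1, conn_trans (ce h1) (cg h2)⟩
  · exact ⟨conn_trans (cf h1) (conn_symm (cg h2)), cf h1⟩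

end Graph

/-! ## The theorems -/

section Main

open Classical

variable {V : Type*} {E : Type*} [Fintype E] [DecidableEq E] {R : Type*} [Field R]
  [LinearOrder R] [IsStrictOrderedRing R]
variable (ends : E → Sym2 V) (o a₁ a₂ a₃ b : V)

omit [Fintype E] [DecidableEq E] [LinearOrder R] [IsStrictOrderedRing R] in
/-- A configuration with `b ∈ C(a₁)` and `a₃ ∈ C(a₁)` either fails `Q` or has the state
`mkSt false L_o true true H_o false false`. -/
lemma st_of_conn_b_a3 (u : Config E) (hb : Conn ends u a₁ b) (h3 : Conn ends u a₁ a₃) :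
    (st ends o a₁ a₂ a₃ b u).q' = true ∨
      st ends o a₁ a₂ a₃ b u =
        mkSt false (decide (Conn ends u a₁ o)) true true (decide (Conn ends u a₂ o)) false false := by
  by_cases hq : Conn ends u a₂ a₁
  · left
    unfold st St.q'
    exact decide_eq_true hq
  · right
    have hb' : ¬ Conn ends u a₂ b := fun h' => hq (conn_trans h' (conn_symm hb))
    have h3' : ¬ Conn ends u a₂ a₃ := fun h' => hq (conn_trans h' (conn_symm h3))
    unfold st mkSt
    simp only [hb, h3, hb', h3', decide_true, decide_false, hq]

omit [Fintype E] [DecidableEq E] [LinearOrder R] [IsStrictOrderedRing R] in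
/-- A configuration with `o ∈ C(a₁)` and `a₃ ∈ C(a₁)` either fails `Q` or has the state
`mkSt false true L_b true false H_b false`. -/
lemma st_of_conn_o_a3 (u : Config E) (ho : Conn ends u a₁ o) (h3 : Conn ends u a₁ a₃) :
    (st ends o a₁ a₂ a₃ b u).q' = true ∨
      st ends o a₁ a₂ a₃ b u =
        mkSt false true (decide (Conn ends u a₁ b)) true false (decide (Conn ends u a₂ b)) false := by
  by_cases hq : Conn ends u a₂ a₁
  · left
    unfold st St.q'
    exact decide_eq_true hq
  · right
    have ho' : ¬ Conn ends u a₂ o := fun h' => hq (conn_trans h' (conn_symm ho))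
    have h3' : ¬ Conn ends u a₂ a₃ := fun h' => hq (conn_trans h' (conn_symm h3))
    unfold st mkSt
    simp only [ho, h3, ho', h3', decide_true, decide_false, hq]

omit [Fintype E] [DecidableEq E] [LinearOrder R] [IsStrictOrderedRing R] in
/-- The symmetrised kernel vanishes on a triple two of whose copies carry `b, a₃ ∈ C(a₁)`. -/
lemma KBsym_st_eq_zero_of_two_b (t u v : Config E) (hub : Conn ends u a₁ b) (hu3 : Conn ends u a₁ a₃)
    (hvb : Conn ends v a₁ b) (hv3 : Conn ends v a₁ a₃) :
    KBsym (st ends o a₁ a₂ a₃ b t) (st ends o a₁ a₂ a₃ b u) (st ends o a₁ a₂ a₃ b v) = 0 := by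
  rcases st_of_conn_b_a3 ends o a₁ a₂ a₃ b u hub hu3 with hqu | hsu
  · exact KBsym_eq_zero_of_q' _ _ _ (Or.inr (Or.inl hqu))
  rcases st_of_conn_b_a3 ends o a₁ a₂ a₃ b v hvb hv3 with hqv | hsv
  · exact KBsym_eq_zero_of_q' _ _ _ (Or.inr (Or.inr hqv))
  rw [hsu, hsv]
  exact KBsym_eq_zero_of_two_Lb3 _ _ _ _ _ _ _

omit [Fintype E] [DecidableEq E] [LinearOrder R] [IsStrictOrderedRing R] in
/-- The symmetrised kernel vanishes on a triple two of whose copies carry `o, a₃ ∈ C(a₁)`. -/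
lemma KBsym_st_eq_zero_of_two_o (t u v : Config E) (huo : Conn ends u a₁ o) (hu3 : Conn ends u a₁ a₃)
    (hvo : Conn ends v a₁ o) (hv3 : Conn ends v a₁ a₃) :
    KBsym (st ends o a₁ a₂ a₃ b t) (st ends o a₁ a₂ a₃ b u) (st ends o a₁ a₂ a₃ b v) = 0 := by
  rcases st_of_conn_o_a3 ends o a₁ a₂ a₃ b u huo hu3 with hqu | hsu
  · exact KBsym_eq_zero_of_q' _ _ _ (Or.inr (Or.inl hqu))
  rcases st_of_conn_o_a3 ends o a₁ a₂ a₃ b v hvo hv3 with hqv | hsv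
  · exact KBsym_eq_zero_of_q' _ _ _ (Or.inr (Or.inr hqv))
  rw [hsu, hsv]
  exact KBsym_eq_zero_of_two_Lo3 _ _ _ _ _ _ _

omit [LinearOrder R] [IsStrictOrderedRing R] in
/-- Six times the typed base, as the typed count of the symmetrised kernel on states. -/
lemma six_mul_typedCount_KBsym'' (F : Finset E) (z : Config E) (τ : E → ℕ)
    (hτ : ∀ e ∈ F, τ e = 1 ∨ τ e = 2) :
    6 * typedCount F z τ (K3 ends o a₁ a₂ a₃ b : Config E → Config E → Config E → R) =
      typedCount F z τ (fun x y w => ((KBsym (st ends o a₁ a₂ a₃ b x) (st ends o a₁ a₂ a₃ b y)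
        (st ends o a₁ a₂ a₃ b w) : ℤ) : R)) := by
  rw [six_mul_typedCount F z τ hτ]
  refine TypedRed.typedCount_congr_K F z τ fun x y w => ?_
  simp only [K3_eq_KB ends o a₁ a₂ a₃ b]
  unfold KBsym
  push_cast
  ring_nf

/-- **The triangle `{a₁, b, a₃}` of type-2 edges kills every typed base.** -/
theorem typedCount_eq_zero_of_triangle_b {e f g : E} (he : ends e = s(a₁, b)) (hf : ends f = s(a₁, a₃))
    (hg : ends g = s(b, a₃)) (F : Finset E) (heF : e ∈ F) (hfF : f ∈ F) (hgF : g ∈ F) (z : Config E)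
    (τ : E → ℕ) (hτ : ∀ e ∈ F, τ e = 1 ∨ τ e = 2) (hτe : τ e = 2) (hτf : τ f = 2) (hτg : τ g = 2) :
    typedCount F z τ (K3 ends o a₁ a₂ a₃ b : Config E → Config E → Config E → R) = 0 := by
  have h6 := six_mul_typedCount_KBsym'' (R := R) ends o a₁ a₂ a₃ b F z τ hτ
  have hK : typedCount F z τ (fun x y w => ((KBsym (st ends o a₁ a₂ a₃ b x) (st ends o a₁ a₂ a₃ b y)
      (st ends o a₁ a₂ a₃ b w) : ℤ) : R)) = 0 := by
    rw [← typedCount_zero_kernel F z τ]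
    refine typedCount_congr_on_support F z τ fun x y w _ hτ' => ?_
    have h2e := hτ' e heF
    have h2f := hτ' f hfF
    have h2g := hτ' g hgF
    rw [hτe] at h2e
    rw [hτf] at h2f
    rw [hτg] at h2g
    have key : ∀ u : Config E, ((u e = true ∧ u f = true) ∨ (u e = true ∧ u g = true) ∨
        (u f = true ∧ u g = true)) → Conn ends u a₁ b ∧ Conn ends u a₁ a₃ :=
      fun u hu => conn_of_two_open ends a₁ a₃ he hf hg u hu
    rcases two_copies_two_open h2e h2f h2g with ⟨hx, hy⟩ | ⟨hx, hw⟩ | ⟨hy, hw⟩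
    · rw [KBsym_comm_right, KBsym_comm_left]
      exact_mod_cast KBsym_st_eq_zero_of_two_b ends o a₁ a₂ a₃ b w x y (key x hx).1 (key x hx).2
        (key y hy).1 (key y hy).2
    · rw [KBsym_comm_left]
      exact_mod_cast KBsym_st_eq_zero_of_two_b ends o a₁ a₂ a₃ b y x w (key x hx).1 (key x hx).2
        (key w hw).1 (key w hw).2
    · exact_mod_cast KBsym_st_eq_zero_of_two_b ends o a₁ a₂ a₃ b x y w (key y hy).1 (key y hy).2
        (key w hw).1 (key w hw).2
  rw [hK] at h6
  have h6' : (6 : R) ≠ 0 := by norm_num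
  exact (mul_eq_zero.mp h6).resolve_left h6'

/-- **The triangle `{a₁, o, a₃}` of type-2 edges kills every typed base.** -/
theorem typedCount_eq_zero_of_triangle_o {e f g : E} (he : ends e = s(a₁, o)) (hf : ends f = s(a₁, a₃))
    (hg : ends g = s(o, a₃)) (F : Finset E) (heF : e ∈ F) (hfF : f ∈ F) (hgF : g ∈ F) (z : Config E)
    (τ : E → ℕ) (hτ : ∀ e ∈ F, τ e = 1 ∨ τ e = 2) (hτe : τ e = 2) (hτf : τ f = 2) (hτg : τ g = 2) :
    typedCount F z τ (K3 ends o a₁ a₂ a₃ b : Config E → Config E → Config E → R) = 0 := by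
  have h6 := six_mul_typedCount_KBsym'' (R := R) ends o a₁ a₂ a₃ b F z τ hτ
  have hK : typedCount F z τ (fun x y w => ((KBsym (st ends o a₁ a₂ a₃ b x) (st ends o a₁ a₂ a₃ b y)
      (st ends o a₁ a₂ a₃ b w) : ℤ) : R)) = 0 := by
    rw [← typedCount_zero_kernel F z τ]
    refine typedCount_congr_on_support F z τ fun x y w _ hτ' => ?_
    have h2e := hτ' e heF
    have h2f := hτ' f hfF
    have h2g := hτ' g hgF
    rw [hτe] at h2e
    rw [hτf] at h2f
    rw [hτg] at h2g
    have key : ∀ u : Config E, ((u e = true ∧ u f = true) ∨ (u e = true ∧ u g = true) ∨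
        (u f = true ∧ u g = true)) → Conn ends u a₁ o ∧ Conn ends u a₁ a₃ :=
      fun u hu => conn_of_two_open ends a₁ a₃ he hf hg u hu
    rcases two_copies_two_open h2e h2f h2g with ⟨hx, hy⟩ | ⟨hx, hw⟩ | ⟨hy, hw⟩
    · rw [KBsym_comm_right, KBsym_comm_left]
      exact_mod_cast KBsym_st_eq_zero_of_two_o ends o a₁ a₂ a₃ b w x y (key x hx).1 (key x hx).2
        (key y hy).1 (key y hy).2
    · rw [KBsym_comm_left]
      exact_mod_cast KBsym_st_eq_zero_of_two_o ends o a₁ a₂ a₃ b y x w (key x hx).1 (key x hx).2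
        (key w hw).1 (key w hw).2
    · exact_mod_cast KBsym_st_eq_zero_of_two_o ends o a₁ a₂ a₃ b x y w (key y hy).1 (key y hy).2
        (key w hw).1 (key w hw).2
  rw [hK] at h6
  have h6' : (6 : R) ≠ 0 := by norm_num
  exact (mul_eq_zero.mp h6).resolve_left h6'

/-- The mirror of the `b`-triangle at `a₂`. -/
theorem typedCount_eq_zero_of_triangle_b' {e f g : E} (he : ends e = s(a₂, b)) (hf : ends f = s(a₂, a₃))
    (hg : ends g = s(b, a₃)) (F : Finset E) (heF : e ∈ F) (hfF : f ∈ F) (hgF : g ∈ F) (z : Config E)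
    (τ : E → ℕ) (hτ : ∀ e ∈ F, τ e = 1 ∨ τ e = 2) (hτe : τ e = 2) (hτf : τ f = 2) (hτg : τ g = 2) :
    typedCount F z τ (K3 ends o a₁ a₂ a₃ b : Config E → Config E → Config E → R) = 0 := by
  rw [← SwapRoots.typedCount_swap_roots ends o a₁ a₂ a₃ b F z τ]
  exact typedCount_eq_zero_of_triangle_b ends o a₂ a₁ a₃ b he hf hg F heF hfF hgF z τ hτ hτe hτf hτg

/-- The mirror of the `o`-triangle at `a₂`. -/
theorem typedCount_eq_zero_of_triangle_o' {e f g : E} (he : ends e = s(a₂, o)) (hf : ends f = s(a₂, a₃))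
    (hg : ends g = s(o, a₃)) (F : Finset E) (heF : e ∈ F) (hfF : f ∈ F) (hgF : g ∈ F) (z : Config E)
    (τ : E → ℕ) (hτ : ∀ e ∈ F, τ e = 1 ∨ τ e = 2) (hτe : τ e = 2) (hτf : τ f = 2) (hτg : τ g = 2) :
    typedCount F z τ (K3 ends o a₁ a₂ a₃ b : Config E → Config E → Config E → R) = 0 := by
  rw [← SwapRoots.typedCount_swap_roots ends o a₁ a₂ a₃ b F z τ]
  exact typedCount_eq_zero_of_triangle_o ends o a₂ a₁ a₃ b he hf hg F heF hfF hgF z τ hτ hτe hτf hτg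

end Main

end Triangle

end CovForm

end Summit.Ventures.PercRepro2
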